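import Mathlib
import HarnessLib

/-!
# Item `LrcModEntire` (stmt-NavierStokesRegularity-20428) — (Q4) entrance input (hR): DANSKIN'S THEOREM — the maximum of a `C¹` family over a compact set is differentiable
# at a parameter where the maximiser is unique, with derivative the partial derivative at the maximiser

ns-k2-port-2 g5 (helper prover under the LEAD of item 20428, ns-poloidal-K2-p3 g14; `--supports stmt-NavierStokesRegularity-20428 --as helper`).
The LEAD's Fermat-at-a-web-point `…RidgeWebEntrance.fderiv_uncurry_eq_of_ridgeWeb` needs `DifferentiableAt ℝ (uncurry R) (τ₀, z₀)` for the homogeneous cross-section maximum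
`R(τ,z) = max_{|n| ≤ r} σU₂(−1+τ, Γ s + nν_Γ s + z e₂)` delivered by `…RidgeHullValues`.  This is Danskin's envelope theorem (J. M. Danskin, *The theory of Max-Min*, 1967,
Ch. I; here the elementary unique-maximiser case), class-free:

* `eventually_argmax_subset` — UPPER SEMICONTINUITY OF THE ARGMAX: `g` jointly continuous at `{p₀} × K` (`K` compact), the maximiser `n₀` of `g p₀` on `K` unique ⇒ for `p` near `p₀`
  every maximiser of `g p` on `K` lies in any prescribed neighbourhood of `n₀` (generalized tube lemma);
* **`hasFDerivAt_sSup_of_unique_argmax`** — if moreover `p ↦ g p n` has a derivative `D p n` for `(p, n)` near `(p₀, n₀)`, jointly continuous at `(p₀, n₀)`, and the slices `g p` are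
  continuous on `K` for `p` near `p₀`, then `p ↦ sSup (g p '' K)` has derivative `D p₀ n₀` at `p₀` (lower bound: the value at `n₀`; upper bound: mean value inequality at the moving
  maximiser `n_p → n₀`).
Consumers take `P = ℝ × ℝ` (`p = (τ, z)`), `K = [−r, r]`, uniqueness from the transversal non-degeneracy `−∂ₙ²g ≥ κ₀/2` near the centre and the cold lateral values.

WHAT THIS IS NOT: not a claim about Navier–Stokes regularity — a calculus lemma for the entrance of the research cell (Q4) on hypothetical profiles (bears_on LADDER-NS N0, item 20428 /
crux 19708; 20428/19708/27893 OPEN).  No summit statement is proved here.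
-/

noncomputable section

-- the summit and its single sub-problem share the name (CONVENTIONS §1), as in every Theorems file
set_option linter.dupNamespace false

namespace Summit.NavierStokesRegularity.NavierStokesRegularity.Theorems.PoloidalWindowDoorLrcModEntireRidgeDanskin

open Set Filter Topology Metric Function Asymptotics

variable {P : Type*} [NormedAddCommGroup P] [NormedSpace ℝ P] {X : Type*} [TopologicalSpace X]
  {g : P → X → ℝ} {K : Set X} {p₀ : P} {n₀ : X}

omit [NormedSpace ℝ P] in
/-- **Uniform closeness of the slices near `p₀`** (joint continuity at `{p₀} × K`, `K` compact, via the generalized tube lemma). [folklore] -/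
theorem eventually_forall_abs_sub_lt (hK : IsCompact K) (hcont : ∀ n ∈ K, ContinuousAt (fun q : P × X => g q.1 q.2) (p₀, n)) {η : ℝ} (hη : 0 < η) :
    ∀ᶠ p in 𝓝 p₀, ∀ n ∈ K, |g p n - g p₀ n| < η := by
  set S : Set (P × X) := {q | |g q.1 q.2 - g p₀ q.2| < η} with hS
  have hsub : ({p₀} : Set P) ×ˢ K ⊆ interior S := by
    rintro ⟨p, n⟩ ⟨hp, hn⟩
    have hp' : p = p₀ := hp
    subst hp'
    rw [mem_interior_iff_mem_nhds]
    -- `q ↦ g q.1 q.2 − g p₀ q.2` is continuous at `(p₀, n)` and vanishes there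
    have h1 : ContinuousAt (fun q : P × X => g q.1 q.2) (p, n) := hcont n hn
    have h2 : ContinuousAt (fun q : P × X => g p q.2) (p, n) := by
      have : (fun q : P × X => g p q.2) = (fun q : P × X => g q.1 q.2) ∘ fun q : P × X => (p, q.2) := rfl
      rw [this]
      exact ContinuousAt.comp (by exact hcont n hn) ((continuousAt_const.prodMk continuousAt_snd))
    have h3 : ContinuousAt (fun q : P × X => |g q.1 q.2 - g p q.2|) (p, n) := (h1.sub h2).abs
    have h0 : (fun q : P × X => |g q.1 q.2 - g p q.2|) (p, n) < η := by simp [hη]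
    exact h3.preimage_mem_nhds (isOpen_Iio.mem_nhds h0)
  obtain ⟨U, V, hU, -, hpU, hKV, hUV⟩ := generalized_tube_lemma isCompact_singleton hK isOpen_interior hsub
  filter_upwards [hU.mem_nhds (hpU (mem_singleton p₀))] with p hp n hn
  have hmem : (p, n) ∈ S := interior_subset (hUV (mk_mem_prod hp (hKV hn)))
  exact hmem

omit [NormedSpace ℝ P] in
/-- **UPPER SEMICONTINUITY OF THE ARGMAX at a unique maximiser.**  For `p` near `p₀`, every maximiser of `g p` on the compact `K` lies in the open neighbourhood `V` of the unique
maximiser `n₀` of `g p₀`. [folklore] -/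
theorem eventually_argmax_subset (hK : IsCompact K) (hcont : ∀ n ∈ K, ContinuousAt (fun q : P × X => g q.1 q.2) (p₀, n))
    (hn₀ : n₀ ∈ K) (huniq : ∀ n ∈ K, n ≠ n₀ → g p₀ n < g p₀ n₀) {V : Set X} (hV : IsOpen V) (hn₀V : n₀ ∈ V) :
    ∀ᶠ p in 𝓝 p₀, ∀ n ∈ K, (∀ n' ∈ K, g p n' ≤ g p n) → n ∈ V := by
  -- the slice `g p₀` is continuous on `K`
  have hsl : ContinuousOn (g p₀) K := fun n hn =>
    ((hcont n hn).comp_of_eq ((continuousAt_const.prodMk continuousAt_id)) rfl).continuousWithinAt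
  by_cases hempty : (K \ V) = ∅
  · refine Eventually.of_forall fun p n hn _ => ?_
    by_contra hnV
    have : n ∈ K \ V := ⟨hn, hnV⟩
    rw [hempty] at this
    exact this
  -- the maximum of `g p₀` over the compact `K \ V` is strictly below `g p₀ n₀`
  have hK' : IsCompact (K \ V) := hK.diff hV
  have hne : (K \ V).Nonempty := nonempty_iff_ne_empty.2 hempty
  obtain ⟨n', hn'K, hmax'⟩ := hK'.exists_isMaxOn hne (hsl.mono fun x hx => hx.1)
  have hlt : g p₀ n' < g p₀ n₀ := huniq n' hn'K.1 (fun h => hn'K.2 (h ▸ hn₀V))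
  set η : ℝ := (g p₀ n₀ - g p₀ n') / 3 with hη
  have hη0 : 0 < η := by rw [hη]; linarith
  filter_upwards [eventually_forall_abs_sub_lt hK hcont hη0] with p hp n hn hnmax
  by_contra hnV
  have h1 := abs_lt.1 (hp n hn)
  have h2 := abs_lt.1 (hp n₀ hn₀)
  have h3 : g p₀ n ≤ g p₀ n' := hmax' ⟨hn, hnV⟩
  have h4 := hnmax n₀ hn₀
  linarith

/-- **DANSKIN'S THEOREM (unique maximiser).**  See the module docstring. [folklore] (Danskin 1967, Ch. I.) -/
theorem hasFDerivAt_sSup_of_unique_argmax (hK : IsCompact K) (hcont : ∀ n ∈ K, ContinuousAt (fun q : P × X => g q.1 q.2) (p₀, n))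
    (hslice : ∀ᶠ p in 𝓝 p₀, ContinuousOn (g p) K)
    (hn₀ : n₀ ∈ K) (huniq : ∀ n ∈ K, n ≠ n₀ → g p₀ n < g p₀ n₀)
    {D : P → X → P →L[ℝ] ℝ} (hD : ∀ᶠ q in 𝓝 (p₀, n₀), HasFDerivAt (fun p => g p q.2) (D q.1 q.2) q.1)
    (hDc : ContinuousAt (fun q : P × X => D q.1 q.2) (p₀, n₀)) :
    HasFDerivAt (fun p => sSup (g p '' K)) (D p₀ n₀) p₀ := by
  set L : P →L[ℝ] ℝ := D p₀ n₀ with hL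
  -- `R p₀ = g p₀ n₀`
  have hR₀ : sSup (g p₀ '' K) = g p₀ n₀ := by
    refine IsGreatest.csSup_eq ⟨⟨n₀, hn₀, rfl⟩, ?_⟩
    rintro _ ⟨n, hn, rfl⟩
    by_cases h : n = n₀
    · rw [h]
    · exact (huniq n hn h).le
  rw [hasFDerivAt_iff_isLittleO, isLittleO_iff]
  intro c hc
  -- (1) the lower bound from the value at `n₀`
  have hd₀ : HasFDerivAt (fun p => g p n₀) L p₀ := by
    have := hD.self_of_nhds
    exact this
  have hlow : ∀ᶠ p in 𝓝 p₀, ‖g p n₀ - g p₀ n₀ - L (p - p₀)‖ ≤ c * ‖p - p₀‖ :=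
    (isLittleO_iff.1 (hasFDerivAt_iff_isLittleO.1 hd₀)) hc
  -- (2) a ball around `p₀` and an open `V ∋ n₀` where `g(·, n)` is differentiable with `‖D − L‖ ≤ c`
  have hgood : {q : P × X | HasFDerivAt (fun p => g p q.2) (D q.1 q.2) q.1 ∧ ‖D q.1 q.2 - L‖ < c} ∈ 𝓝 (p₀, n₀) := by
    have h2 : ∀ᶠ q in 𝓝 (p₀, n₀), ‖D q.1 q.2 - L‖ < c := by
      have h := (Metric.tendsto_nhds.1 hDc) c hc
      refine h.mono fun q hq => ?_
      rwa [dist_eq_norm] at hq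
    exact hD.and h2
  obtain ⟨u, hu, v, hv, huv⟩ := mem_nhds_prod_iff.1 hgood
  obtain ⟨ε, hε, hball⟩ := Metric.mem_nhds_iff.1 hu
  obtain ⟨V, hVv, hVo, hn₀V⟩ := mem_nhds_iff.1 hv
  -- (3) argmax in `V` and continuity of the slices, eventually
  have harg := eventually_argmax_subset hK hcont hn₀ huniq hVo hn₀V
  have hballev : ∀ᶠ p in 𝓝 p₀, p ∈ ball p₀ ε := ball_mem_nhds p₀ hε
  filter_upwards [hlow, harg, hslice, hballev] with p hplow hparg hpsl hpball
  -- the image of `K` under the slice `g p` is compact and non-empty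
  have hKp : IsCompact (g p '' K) := hK.image_of_continuousOn hpsl
  have hKne : (g p '' K).Nonempty := ⟨_, n₀, hn₀, rfl⟩
  -- lower bound
  have hlb : g p n₀ ≤ sSup (g p '' K) := le_csSup hKp.bddAbove ⟨n₀, hn₀, rfl⟩
  -- a maximiser `n₁` of `g p` on `K`; it lies in `V`
  obtain ⟨n₁, hn₁K, hn₁eq⟩ := hKp.sSup_mem hKne
  have hn₁max : ∀ n' ∈ K, g p n' ≤ g p n₁ := fun n' hn' => by
    rw [hn₁eq]; exact le_csSup hKp.bddAbove ⟨n', hn', rfl⟩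
  have hn₁V : n₁ ∈ V := hparg n₁ hn₁K hn₁max
  -- mean value inequality for `g(·, n₁) − L` on the ball
  have hmv : ‖g p n₁ - g p₀ n₁ - L (p - p₀)‖ ≤ c * ‖p - p₀‖ := by
    have hder : ∀ x ∈ ball p₀ ε, HasFDerivWithinAt (fun p => g p n₁) (D x n₁) (ball p₀ ε) x := fun x hx => by
      have hq := huv (mk_mem_prod (hball hx) (hVv hn₁V))
      exact hq.1.hasFDerivWithinAt
    have hbd : ∀ x ∈ ball p₀ ε, ‖D x n₁ - L‖ ≤ c := fun x hx => by
      have hq := huv (mk_mem_prod (hball hx) (hVv hn₁V))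
      exact hq.2.le
    exact (convex_ball p₀ ε).norm_image_sub_le_of_norm_hasFDerivWithin_le' hder hbd (mem_ball_self hε) hpball
  -- `g p₀ n₁ ≤ R p₀`
  have hub₀ : g p₀ n₁ ≤ g p₀ n₀ := by
    by_cases h : n₁ = n₀
    · rw [h]
    · exact (huniq n₁ hn₁K h).le
  -- combine
  rw [hR₀, Real.norm_eq_abs, abs_le]
  have hLsub : L (p - p₀) = L p - L p₀ := map_sub L p p₀
  have e1 := (abs_le.1 (by simpa [Real.norm_eq_abs] using hplow))
  have e2 := (abs_le.1 (by simpa [Real.norm_eq_abs] using hmv))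
  constructor
  · linarith [e1.1, hLsub]
  · rw [← hn₁eq]; linarith [e2.2, hLsub]

end Summit.NavierStokesRegularity.NavierStokesRegularity.Theorems.PoloidalWindowDoorLrcModEntireRidgeDanskin

end
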